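import Summits.RiemannHypothesis.RiemannHypothesis.Theorems.TiltedLandingLaw421R3Lens1CoverageRS2
import Summits.RiemannHypothesis.RiemannHypothesis.Theorems.TiltedLandingLaw421R3SuccNested

/-!
# TiltedLandingLaw421R3 — lens-1 (O2-b, director (CA526)(4)): TOP-OF-CLUSTER PINNING, typed, and its kernel reduction

LENS-1 gen-4 module image `rh33346-cover/lens-1/Pinning-v1.lean` (landing target `…/Theorems/TiltedLandingLaw421R3Lens1Pinning.lean`;
imports the LANDED `…R3Lens1CoverageRS2` (v10q SUCC stub `RegHungCut10S`) and `…R3SuccNested` (`RhW08.SuccB.stTrkDQ_succ_of_nested`) —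
checked BY IMPORT, nothing inlined; namespace `RhW08.Lens1Pinning`; 0 `sorry`, no instances/notation, FQN-cites only).

CONTENT.  crit-1 g3's CUT-7 lemma candidate L★★★ («top-of-cluster pinning»; critic numerics 0/381 373 random + 0/1.04 M adversarial,
extremal = pure tilt with the child ON the Jensen circle; the weaker L★/L★★ are FALSE at 14.5 % / 0.146 % and are NOT typed) becomes the
OPEN law `TopPinning`; the umbrella end-state becomes `UmbrellaTop` and the residual law `RegUmbrella11S`; and the director's requested
kernel reduction is PROVED:

* `succ_or_umbrella` — on a legal frame with a level-`j` band state and no Ready′ level `≤ j`, `TopPinning` yields a level-(j+1) band state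
  OR the umbrella configuration (the TALLEST band state `T`, which exists by `RhW08.QuadW.levelFinite_stTrkDQ`, is disc-touched by a strictly
  taller zero `b` of `f^{(j)}`, necessarily NOT a band state).  Mechanism: apply `TopPinning` at `T`; a nested non-real child is a successor by
  `RhW08.SuccB.stTrkDQ_succ_of_nested`; a real NL event within `Im T` of `Re T` lies in the `TiltReady` range by
  `RhW08.QuadW.abs_re_sub_le_of_stTrkDQ` + `RhW08.QuadW.band_radius_lt_range'`, contradicting `¬ ReadyR2`.
* `umbrella_beyond_wall` — the umbrella zero lies strictly outside the closed column (`RhW08.Column.stTrkDQ_of_column`), i.e. it is lens-1's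
  out-of-band intruder a★ of `Lens1_Exile.lean` seen from the top of the cluster: SAME species (out-of-band upper zero of `f^{(j)}` beyond the
  wall whose disc reaches the band cluster), sharper individual (it touches the tallest band state; a★ only has to shadow the window).
* `regHungCut10S_of_topPinning : TopPinning → RegUmbrella11S → RegHungCut10S` and the monotone converse for the residual — the candidate
  v11q SUCC split {analytic law `TopPinning`, residual `RegUmbrella11S`}.  NOT tonight's registry (director).

WHY `TopPinning` MIGHT FAIL: an equal-height or lower cluster mate stealing the child just outside the closed disc without producing an NL
event (partial-overlap theft is what kills L★★ at 0.146 %; the strict-taller exclusion is exactly what the numerics say saves L★★★ — no proof);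
sources: crit-1 g3 CUT 7 (`rh33346-cover/CRITIC-LOG.md` «CUT 7», files `crit-g3/a3v2/`), Sheil-Small, Complex Polynomials §9.1.2–9.1.5
(Jensen, Walsh's corollary, level region `{Im F′/F ≥ 0} ⊂ ∪ discs`, Craven–Csordas–Smith), Tyaglov arXiv:0902.0413 (Hawaii conjecture).

HONEST LABEL: nothing here bears on the truth of RH; RH is not proved; 33346/33347 stay OPEN; `TopPinning`/`RegUmbrella11S` are OPEN.
-/

namespace RhW08.Lens1Pinning

open Complex Set
open scoped ComplexConjugate
open Literature.Analysis.Complex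
open Summit.RiemannHypothesis.RiemannHypothesis.Theorems.Splittings.JensenWindow
open RhIdea6.G17.W07C7 RhIdea6.G17.W07C7.Rev6 RhIdea6.G18.W07C8.Law421BirthS RhIdea6.G19.W07C11.Seam
open RhIdea6.G20.W07C12.Frac RhIdea6.G20.W07C12.StColP RhW07.C12.FieldSplit RhIdea6.G21.W07C13.TentMax
open RhW07.C14.TwoSided RhW07.C14.Classes RhW07.C14.Lineage RhW07.C14.Booking
open RhW07.C13.Heredity RhIdea6.G22.W07C15pre.Injection RhW07.E3.Cell RhW07.E3.Lit
open RhW08.Round1 RhW08.StSwap RhW08.Round2 RhW08.QuadW RhW08.SealSwapQ RhW08.SealSwap RhW08.SuccB RhW08.SuccSplit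
open RhW08.SuccTheft RhW08.Column RhW08.Hurwitz RhW08.ClusterQ RhW08.ClusterQM RhW08.NewtonDoor RhW08.NewtonDoorGenusOne RhW08.PurseP
open RhW08.Lens1SignCut RhW08.Lens1Coverage

/-- `a` has NO STRICTLY TALLER TOUCHER at level `j`: every zero `b` of `f^{(j)}` with `Im b > Im a` has its closed Jensen disc disjoint from
`a`'s (`Im a + Im b < |Re a − Re b|`).  Equal-height and lower mates are unrestricted. -/
def NoTallerToucher (f : ℂ → ℂ) (j : ℕ) (a : ℂ) : Prop :=
  ∀ b : ℂ, iteratedDeriv j f b = 0 → a.im < b.im → a.im + b.im < |a.re - b.re|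

/-- ★ TYPED OPEN LAW L★★★ — TOP-OF-CLUSTER PINNING (crit-1 g3, CUT 7): on a legal frame, an upper zero `a` of `f^{(j)}` with no strictly
taller toucher has, in its CLOSED Jensen disc, a non-real zero of `f^{(j+1)}` (`NestedStep a w`) or a real NL event `x`, `|x − Re a| ≤ Im a`. -/
def TopPinning : Prop :=
  ∀ (η : ℝ) (f : ℂ → ℂ) (x₀ s hmax R Hs : ℝ) (B : ℕ), EngineHyps5 2 η f x₀ s hmax R Hs B → ∀ (j : ℕ) (a : ℂ),
    iteratedDeriv j f a = 0 → 0 < a.im → NoTallerToucher f j a →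
    (∃ w : ℂ, iteratedDeriv (j + 1) f w = 0 ∧ w.im ≠ 0 ∧ NestedStep a w) ∨ (∃ x : ℝ, |x - a.re| ≤ a.im ∧ NLEventOf f j x)

/-- UMBRELLA (top form): the TALLEST level-`j` band state `T` is disc-touched by a strictly taller zero `b` of `f^{(j)}`, which is not a
band state (out of band; beyond the wall by `umbrella_beyond_wall`). -/
def UmbrellaTop (η : ℝ) (f : ℂ → ℂ) (x₀ s hmax R Hs : ℝ) (B : ℕ) (j : ℕ) : Prop :=
  ∃ T b : ℂ, StTrkDQ η f x₀ s hmax R Hs B j T ∧ (∀ w : ℂ, StTrkDQ η f x₀ s hmax R Hs B j w → w.im ≤ T.im) ∧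
    iteratedDeriv j f b = 0 ∧ T.im < b.im ∧ |T.re - b.re| ≤ T.im + b.im ∧ ¬ StTrkDQ η f x₀ s hmax R Hs B j b

/-- ★ TYPED OPEN RESIDUAL — `RegUmbrella11S`: the v10q SUCC stub's binders plus the umbrella configuration ⇒ a level-(j+1) band state. -/
def RegUmbrella11S : Prop :=
  ∀ (η : ℝ) (f : ℂ → ℂ) (x₀ s hmax R Hs : ℝ) (B : ℕ), EngineHyps5 2 η f x₀ s hmax R Hs B → ∀ (j : ℕ) (v : ℂ),
    IsLowest StTrkDQ η f x₀ s hmax R Hs B j v → ¬ ReadyR2 η f x₀ s hmax R Hs B j v →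
    ¬ AllInBandInRangeWindow f x₀ R Hs j v → ¬ Dimple f j v → DiscOverlap f j v →
    iteratedDeriv (j + 1) f v ≠ 0 →
    ¬ CellF f j v → ¬ CellNb f x₀ R Hs j v → ¬ LandingDipDeep f x₀ R Hs j v → ¬ LandingDipW f x₀ R Hs j v →
    ¬ IsolatedNewtonL f x₀ R Hs j v → ¬ HungBox f x₀ R Hs j → (∃ i : ℕ, i ≤ j ∧ ¬ ColumnCuttable f x₀ R Hs i) →
    UmbrellaTop η f x₀ s hmax R Hs B j →
    ∃ u : ℂ, StTrkDQ η f x₀ s hmax R Hs B (j + 1) u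

/-- ★★ SUCCESSOR OR UMBRELLA (proved): `TopPinning` + a level-`j` band state + no Ready′ level `≤ j` ⇒ successor ∨ `UmbrellaTop`. -/
theorem succ_or_umbrella (hP : TopPinning) {η : ℝ} {f : ℂ → ℂ} {x₀ s hmax R Hs : ℝ} {B j : ℕ} {v : ℂ}
    (hE : EngineHyps5 2 η f x₀ s hmax R Hs B) (hv : StTrkDQ η f x₀ s hmax R Hs B j v) (hnR : ¬ ReadyR2 η f x₀ s hmax R Hs B j v) :
    (∃ u : ℂ, StTrkDQ η f x₀ s hmax R Hs B (j + 1) u) ∨ UmbrellaTop η f x₀ s hmax R Hs B j := by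
  classical
  have hfin := levelFinite_stTrkDQ η f x₀ s hmax R Hs B hE j
  obtain ⟨T, hT, hTmax⟩ := Set.exists_max_image _ (fun u : ℂ => u.im) hfin ⟨v, hv⟩
  have hT' : StTrkDQ η f x₀ s hmax R Hs B j T := hT
  by_cases hnt : NoTallerToucher f j T
  · rcases hP η f x₀ s hmax R Hs B hE j T hT'.2.1 hT'.2.2.1 hnt with ⟨w, hw0, hwim, hn⟩ | ⟨x, hx, hNL⟩
    · obtain ⟨u, hu0, hupos, hure, huim⟩ := exists_upper_zero_of_nonreal hE.1 hE.2.1 (j + 1) hw0 hwim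
      have hn' : NestedStep T u := by
        unfold NestedStep at hn ⊢
        have h2 : u.im ^ 2 = w.im ^ 2 := by rw [← sq_abs, huim, sq_abs]
        rw [hure, h2]; exact hn
      exact Or.inl ⟨u, RhW08.SuccB.stTrkDQ_succ_of_nested hE hT' hu0 hupos hn'⟩
    · exfalso
      apply hnR
      have hHs : 0 ≤ Hs := hE.2.2.2.2.2.2.2.1
      have h2Hs : 2 * Hs ≤ R := hE.2.2.2.2.2.2.2.2.2.1
      have hre := abs_re_sub_le_of_stTrkDQ hHs hT'
      have hrad := band_radius_lt_range' hHs h2Hs (R_pos_of_engine hE) j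
      have hTim : T.im ≤ Hs := hT'.2.2.2.2
      have hrange : |x - x₀| < ((j : ℝ) + 3) * R / 2 := by
        calc |x - x₀| ≤ |x - T.re| + |T.re - x₀| := abs_sub_le x T.re x₀
          _ ≤ T.im + (R / 2 + Real.sqrt j * Hs) := add_le_add hx hre
          _ < ((j : ℝ) + 3) * R / 2 := by linarith
      have ht : TiltReady η f x₀ s hmax R Hs B j v := ⟨x, hrange, hNL⟩
      exact cumReady_of_ready (Ready := WinOrTilt) (Or.inr ht)
  · right
    unfold NoTallerToucher at hnt
    push Not at hnt
    obtain ⟨b, hb0, hbim, hble⟩ := hnt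
    exact ⟨T, b, hT', hTmax, hb0, hbim, hble, fun hb => absurd (hTmax b hb) (not_le.mpr hbim)⟩

/-- ★ The umbrella zero lies strictly OUTSIDE the closed column (contrapositive of column immunity `RhW08.Column.stTrkDQ_of_column`):
it is lens-1's out-of-band intruder a★ beyond the wall, seen from the top of the band cluster. -/
theorem umbrella_beyond_wall {η : ℝ} {f : ℂ → ℂ} {x₀ s hmax R Hs : ℝ} {B j : ℕ} (hE : EngineHyps5 2 η f x₀ s hmax R Hs B)
    (hU : UmbrellaTop η f x₀ s hmax R Hs B j) :
    ∃ T b : ℂ, StTrkDQ η f x₀ s hmax R Hs B j T ∧ iteratedDeriv j f b = 0 ∧ T.im < b.im ∧ |T.re - b.re| ≤ T.im + b.im ∧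
      R / 2 < |b.re - x₀| := by
  obtain ⟨T, b, hT, -, hb0, hbim, hble, hnb⟩ := hU
  refine ⟨T, b, hT, hb0, hbim, hble, ?_⟩
  by_contra hcol
  push Not at hcol
  have hT' : StTrkDQ η f x₀ s hmax R Hs B j T := hT
  exact hnb (stTrkDQ_of_column hE hT'.1 hb0 (hT'.2.2.1.trans hbim) hcol)

/-- ★★ THE KERNEL REDUCTION asked in (CA526)(4): `RegHungCut10S ⟸ TopPinning ∧ RegUmbrella11S`. -/
theorem regHungCut10S_of_topPinning (hP : TopPinning) (hU : RegUmbrella11S) : RegHungCut10S := by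
  intro η f x₀ s hmax R Hs B hE j v hlow hnR hwin hdim hov hz hnF hnNb hnD hnW hnI hB hcut
  rcases succ_or_umbrella hP hE hlow.1 hnR with h | hUmb
  · exact h
  · exact hU η f x₀ s hmax R Hs B hE j v hlow hnR hwin hdim hov hz hnF hnNb hnD hnW hnI hB hcut hUmb

/-- Monotone converse for the residual: the v10q stub gives `RegUmbrella11S` (one more hypothesis, ignored). -/
theorem regUmbrella11S_of_regHungCut10S (h : RegHungCut10S) : RegUmbrella11S :=
  fun η f x₀ s hmax R Hs B hE j v hlow hnR hwin hdim hov hz hnF hnNb hnD hnW hnI hB hcut _ =>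
    h η f x₀ s hmax R Hs B hE j v hlow hnR hwin hdim hov hz hnF hnNb hnD hnW hnI hB hcut

end RhW08.Lens1Pinning
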